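import Summits.Ventures.HodgeRepro2.T5SU11JacobiOrbitRotationLaw

/-!
# The non-radial moments of the orbit point vanish: `∫_G (g·0)ⁿ m_k φ_λ dν = 0` for `n ≥ 1`

The rotation invariance of the law of the orbit point (`T5SU11JacobiOrbitRotationLaw`) in moment form:
left-translating by `rot u` multiplies `(g·0)ⁿ` by `u^{2n}` and leaves `m_k φ_λ dν` unchanged, so the
`n`-th complex moment `I_n = ∫_G (g·0)ⁿ m_k φ_λ dν` satisfies `I_n = u^{2n} I_n` for every `u ∈ K`
(`integral_orbit_pow_mul_eq_rot_mul`); with `u = e^{iπ/(2n)}`, `u^{2n} = −1`, so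

  **`∫_G (g·0)ⁿ m_k φ_λ dν = 0`**,  `n ≥ 1`   (`integral_orbit_pow_mul_eq_zero`)

— for every weight `k` and spectral parameter `λ`, without any integrability hypothesis. In particular
the orbit point is centred, `E_{k,λ}[g·0] = 0` (`integral_orbit_mul_eq_zero`), and isotropic,
`E_{k,λ}[(g·0)²] = 0` (`integral_orbit_sq_mul_eq_zero`): only the radial moments `E|g·0|^{2n}`
(`T5SU11JacobiOrbitMoments`) survive. Nothing is claimed about (N).

Blind lane: Mathlib + the HodgeRepro2 prefix only; no sorry; axioms ⊆ {propext, Classical.choice,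
Quot.sound}.
-/

namespace Summit.Ventures.HodgeRepro2.T5SU11JacobiOrbitMomentsVanish

open MeasureTheory MeasureTheory.Measure Metric Set Filter Topology
open T5SU11Unimodular T5SU11Fibration T5SU11Cartan T5HaarCircle T5BergmanCoefficient
  T5SU11FibrationHaar T5SU11SphericalFunction T5SU11SphericalSymmetry T5SU11SphericalBounds
  T5SU11SphericalContinuous T5SU11JacobiIwasawa T5SU11JacobiTransform T5SU11JacobiWeight
  T5SU11KFiniteMajorantPow T5SU11OrbitMeasure T5SU11CoeffSqCartan T5SU11JacobiOrbitRotationLaw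
open scoped Real

/-- `e^{iπ/(2n)}` is a `2n`-th root of `−1`: `(Circle.exp (π/(2n)))^{2n} = −1` for `n ≥ 1`. -/
theorem circle_exp_pow_eq_neg_one {n : ℕ} (hn : 0 < n) :
    ((Circle.exp (π / (2 * n)) : Circle) : ℂ) ^ (2 * n) = -1 := by
  rw [Circle.coe_exp, ← Complex.exp_nat_mul, ← Complex.exp_pi_mul_I]
  congr 1
  have hn0 : (n : ℂ) ≠ 0 := by exact_mod_cast hn.ne'
  push_cast
  field_simp

section measure

variable [MeasurableSpace Circle] [BorelSpace Circle]

/-- **Left-translation multiplies the `n`-th moment by `u^{2n}`**: for every `u ∈ K`,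
`∫_G (g·0)ⁿ m_k φ_λ dν = u^{2n} ∫_G (g·0)ⁿ m_k φ_λ dν`. -/
theorem integral_orbit_pow_mul_eq_rot_mul (k lam : ℝ) (n : ℕ) (u : Circle) :
    ∫ g, orbit g ^ n * (((1 - ‖orbit g‖ ^ 2) ^ (k / 2) * sph lam g : ℝ) : ℂ) ∂(nu haarCircle)
      = (u : ℂ) ^ (2 * n)
        * ∫ g, orbit g ^ n * (((1 - ‖orbit g‖ ^ 2) ^ (k / 2) * sph lam g : ℝ) : ℂ) ∂(nu haarCircle) := by
  have h := integral_mul_left_eq_self (μ := nu haarCircle)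
    (fun g : SU11 => orbit g ^ n * (((1 - ‖orbit g‖ ^ 2) ^ (k / 2) * sph lam g : ℝ) : ℂ)) (rot u)
  conv_lhs => rw [← h]
  rw [← integral_const_mul]
  refine integral_congr_ae (Filter.Eventually.of_forall fun g => ?_)
  simp only
  rw [orbit_rpow_rot_mul, sph_rot_mul, orbit_rot_mul, mul_pow, ← pow_mul]
  ring

/-- **THE NON-RADIAL MOMENTS VANISH**: `∫_G (g·0)ⁿ m_k φ_λ dν = 0` for `n ≥ 1`, every `k`, `λ`. -/
theorem integral_orbit_pow_mul_eq_zero (k lam : ℝ) {n : ℕ} (hn : 0 < n) :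
    ∫ g, orbit g ^ n * (((1 - ‖orbit g‖ ^ 2) ^ (k / 2) * sph lam g : ℝ) : ℂ) ∂(nu haarCircle) = 0 := by
  have h := integral_orbit_pow_mul_eq_rot_mul k lam n (Circle.exp (π / (2 * n)))
  rw [circle_exp_pow_eq_neg_one hn, neg_one_mul] at h
  -- `I = −I ⇒ 2 I = 0 ⇒ I = 0`
  have h2 : (2 : ℂ) * ∫ g, orbit g ^ n * (((1 - ‖orbit g‖ ^ 2) ^ (k / 2) * sph lam g : ℝ) : ℂ)
      ∂(nu haarCircle) = 0 := by
    linear_combination h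
  rcases mul_eq_zero.mp h2 with h0 | h0
  · exact absurd h0 two_ne_zero
  · exact h0

/-- The orbit point is centred: `∫_G (g·0) m_k φ_λ dν = 0`. -/
theorem integral_orbit_mul_eq_zero (k lam : ℝ) :
    ∫ g, orbit g * (((1 - ‖orbit g‖ ^ 2) ^ (k / 2) * sph lam g : ℝ) : ℂ) ∂(nu haarCircle) = 0 := by
  have h := integral_orbit_pow_mul_eq_zero k lam one_pos
  simpa only [pow_one] using h

/-- The orbit point is isotropic: `∫_G (g·0)² m_k φ_λ dν = 0`. -/
theorem integral_orbit_sq_mul_eq_zero (k lam : ℝ) :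
    ∫ g, orbit g ^ 2 * (((1 - ‖orbit g‖ ^ 2) ^ (k / 2) * sph lam g : ℝ) : ℂ) ∂(nu haarCircle) = 0 :=
  integral_orbit_pow_mul_eq_zero k lam two_pos

end measure

end Summit.Ventures.HodgeRepro2.T5SU11JacobiOrbitMomentsVanish
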